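import Summits.BirchSwinnertonDyer.BirchSwinnertonDyer.Theorems.ErratumRoadFiveIMCDivTransferDivisibleInvariants
import Summits.BirchSwinnertonDyer.BirchSwinnertonDyer.Theorems.ErratumRoadFiveBigRepTorsionDefs
import Summits.BirchSwinnertonDyer.BirchSwinnertonDyer.Theorems.ErratumRoadFiveCoeffBaseChangeCharacterModule
import Summits.BirchSwinnertonDyer.Rank1Residual.X11b.PontryaginCongruence
import Literature.NumberTheory.EllipticCurves.BigGaloisRepSelmer
import HarnessLib

/-!
# Route `ErratumRoadFive` (rung K2, `p ≥ 5`), crux `IMCDivAtErratumDataAllR` (item stmt-BirchSwinnertonDyer-20169), stub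
# S_Fitt: the ASSEMBLY of the member congruence `e_m : (𝒪⟦T⟧ ⊗_Λ X)/p^m ≃ X^Σ(A_g)/p^m` from (b) + Lemma 2.1 + the
# coefficient base change — ABSTRACT over the representations, modulo the two residual inputs (SelBC), (Frob)

Cell `bsd-stepL` (run/shared/lean/pub/bsd-stepL/), seat `bsd-stepL-imc-p1` (prover g9, 2026-08-27); `--supports
stmt-BirchSwinnertonDyer-20169 --as helper`; Theses-free (imports this lineage's g7/g8/g9 kernels
`…TransferDivisibleInvariants`, `…BigRepTorsionDefs`, `…CoeffBaseChangeCharacterModule`, the X11b library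
`PontryaginCongruence`, defn-ty1's `BigGaloisRepSelmer`).

WHAT. The deciding stub's feeder `P2.RoadFF.fittingCongruenceFrameTwoSlotAt_of_members_descent_le[_printed]` (p495387 ∕
p501117) consumes, per Hida member `g_m` with coefficient ring `𝒪`, an `𝒪⟦T⟧`-linear isomorphism
`e m : (𝒪⟦T⟧ ⊗_Λ X) ⧸ (p)^m ≃ N_m ⧸ (p)^m`, `N_m = X^Σ_𝔮(A_{g_m}) = XBig κ ρ_g 𝔮 Σ`. This file ASSEMBLES it from:
* **(b)** — an `𝒪[Γ_K]`-isomorphism of `p^m`-torsion `A_g[p^m] ≃ A_𝒪[p^m]` (F2: `Skinner2016.HidaCongruentMember.exists_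
  equivariant_equiv`, the shape `BigRep.nonempty_torsionRepIso_pow` consumes), transported to the big representations by
  `BigRep.torsionRepIso_pow` (p480662);
* **Lemma 2.1** — `TorsionControl.nonempty_torsionBy_selmer_equiv_of_divisible` (p476122: `Sel(M_𝒪)[p^m] ≃ Sel(M_g)[p^m]`
  from the torsion iso, under `p`-divisibility and `p^m`-divisible global ∕ constrained-local invariants of both big
  modules — the hypotheses stay ABSTRACT here; p479748 ∕ p483719 ∕ p485604 ∕ p486189 discharge them for `E`);
* **Pontryagin** — `PontryaginCongruence.nonempty_quotIdealPow_equiv_of_torsionBy_equiv` (`X/(p)^m ≃ (Sel[p^m])^∨`);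
* **(SelBC)** — RESIDUAL INPUT, abstract: `Sel_{𝒪⟦T⟧}(M_𝒪) ≃ₗ[𝒪⟦T⟧] 𝒪⟦T⟧ ⊗_Λ Sel_Λ(M)` (Selmer groups commute with the
  finite free coefficient extension `ℤ_p → 𝒪`; typer lane (T2), defn-ty1 g3);
* **(Frob)** — RESIDUAL INPUT, abstract: Frobenius data for `ℤ_p → 𝒪` (typer lane (T1)); with it
  `CoeffBaseChange.nonempty_characterModule_powerSeries_baseChange_equiv` (p498960) turns (SelBC) into
  `XBig(M_𝒪) ≃ₗ[𝒪⟦T⟧] 𝒪⟦T⟧ ⊗_Λ XBig(M)`;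
* **(F1)** — abstract: `X ≃ₗ[Λ] XBig κ ρ 𝔮 Σ` (for `X = XAc(E)`: Shapiro `SkinnerUrban2014.prop323_XAc_equiv_XBigDecomp` +
  the `Σ`-bridge `selmerBig_eq_selmerBigDecomp_of_unramifiedOutside`).

## Contents (namespace `Summit.BirchSwinnertonDyer.Rank1Residual.X11b.RoadFFMember`)
* §1 `nonempty_quotPow_XBig_equiv_of_torsionCongruence` — (b) + Lemma 2.1 + Pontryagin: `XBig(M_𝒪)/(p)^m ≃ XBig(M_g)/(p)^m`.
* §2 `nonempty_XBig_equiv_baseChange_of_selBC` — (SelBC) + (Frob): `XBig(M_𝒪) ≃ 𝒪⟦T⟧ ⊗_Λ XBig(M)`;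
  `map_span_C_natCast` (the ideal `(p)Λ` extends to `(p)𝒪⟦T⟧`); `nonempty_quotPow_congr` (quotients along an iso).
* §3 **`nonempty_memberCongruence`** — the binder `e m` VERBATIM in the consumer's quotient shape
  `((𝒪⟦T⟧ ⊗[Λ] X) ⧸ ((span {C p}).map (algebraMap Λ 𝒪⟦T⟧))^m • ⊤) ≃ₗ[𝒪⟦T⟧] (XBig κ ρ_g 𝔮 Σ ⧸ (same)^m • ⊤)`.

HONEST FRAMING: theorems only; CONDITIONAL on every displayed hypothesis, in particular on the two residual inputs
(SelBC), (Frob) which are NOT proved here; nothing is booked; BSD is proved for no pair; no count moves (T7).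

References: [Castella2018Erratum] (b), Lemma 2.1, proof of Thm. 1.1 (pp. 2–4); [Skinner2016PacificMC] §2.3 Lemma 2.3.1,
§2.6 (2-6-1), §3.1 (b); [SkinnerUrban2014] Prop. 3.2.3; STUB2-RESIDUAL-20169-imc-p1-g9.md (evidence #3 on 20169).
-/

set_option autoImplicit false

noncomputable section

open scoped TensorProduct

open CategoryTheory PowerSeries NumberField IsDedekindDomain Field
open Literature.NumberTheory.GaloisRepresentations Literature.NumberTheory.EllipticCurves
  Literature.NumberTheory.EllipticCurves.BigGaloisRep
open Summit.BirchSwinnertonDyer.Rank1Residual.X11b.TorsionControl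

namespace Summit.BirchSwinnertonDyer.Rank1Residual.X11b.RoadFFMember

variable {K : Type} [Field K] [NumberField K] {p : ℕ} [Fact p.Prime]
variable {𝒪 : Type} [CommRing 𝒪] [TopologicalSpace 𝒪] [Algebra ℤ_[p] 𝒪]
variable [TopologicalSpace (PowerSeries 𝒪)]
variable {A𝒪 : Type} [AddCommGroup A𝒪] [Module 𝒪 A𝒪] [TopologicalSpace A𝒪] [DiscreteTopology A𝒪]
  [ContinuousSMul (PowerSeries 𝒪) (BigRepModule 𝒪 p A𝒪)]
variable {Ag : Type} [AddCommGroup Ag] [Module 𝒪 Ag] [TopologicalSpace Ag] [DiscreteTopology Ag]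
  [ContinuousSMul (PowerSeries 𝒪) (BigRepModule 𝒪 p Ag)]

/-! ### §1 (b) + Lemma 2.1 + Pontryagin: the member congruence on the `𝒪`-coefficient side -/

omit [Algebra ℤ_[p] 𝒪] in
/-- **`X^Σ_𝔮(M_𝒪)/(p)^m ≃ X^Σ_𝔮(M_g)/(p)^m` from (b) + Lemma 2.1**, abstract over the two `𝒪`-coefficient Galois modules
`A_𝒪` (intended `E[p^∞] ⊗ 𝒪`) and `A_g`: an `𝒪[Γ_K]`-isomorphism of their `p^m`-torsions (F2's shape), `p`-divisibility
of the two big modules and `p^m`-divisibility of their global and constrained-local invariants (Lemma 2.1's hypotheses,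
divisible form) give an `𝒪⟦T⟧`-linear isomorphism of the Selmer duals modulo `(p)^m` (`BigRep.torsionRepIso_pow` →
`TorsionControl.nonempty_torsionBy_selmer_equiv_of_divisible` → `PontryaginCongruence.nonempty_quotIdealPow_equiv_of_
torsionBy_equiv`). CONDITIONAL on the displayed hypotheses.
[cite: Castella2018Erratum, (b), Lemma 2.1 and proof of Thm. 1.1 (p. 4)] [cite: Skinner2016PacificMC, §2.3 Lemma 2.3.1] -/
theorem nonempty_quotPow_XBig_equiv_of_torsionCongruence (κ : ZpExtension K p) (m : ℕ)
    (ρ𝒪 : ContinuousRep (absoluteGaloisGroup K) 𝒪 A𝒪) (ρg : ContinuousRep (absoluteGaloisGroup K) 𝒪 Ag)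
    (𝔮 : HeightOneSpectrum (𝓞 K)) (S : Set (HeightOneSpectrum (𝓞 K)))
    (hb : ∃ e : Submodule.torsionBy 𝒪 Ag ((p : 𝒪) ^ m) ≃ₗ[𝒪] Submodule.torsionBy 𝒪 A𝒪 ((p : 𝒪) ^ m),
      ∀ (g : absoluteGaloisGroup K) (a : Submodule.torsionBy 𝒪 Ag ((p : 𝒪) ^ m)),
        (e (TorsionControl.torsionRep ρg ((p : 𝒪) ^ m) g a) : A𝒪) = ρ𝒪 g (e a : A𝒪))
    (hdiv𝒪 : Function.Surjective fun x : BigRepModule 𝒪 p A𝒪 ↦ (C (p : 𝒪) : PowerSeries 𝒪) • x)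
    (hglob𝒪 : ∀ w ∈ (AnticyclotomicBigGaloisRep κ ρ𝒪).toTopRep.ρ.invariants,
      ∃ w' ∈ (AnticyclotomicBigGaloisRep κ ρ𝒪).toTopRep.ρ.invariants, (C (p : 𝒪) : PowerSeries 𝒪) ^ m • w' = w)
    (hloc𝒪 : ∀ v ∈ strictSet p 𝔮 S,
      ∀ w ∈ (((AnticyclotomicBigGaloisRep κ ρ𝒪).restrict (localMap K v)).toTopRep).ρ.invariants,
        ∃ w' ∈ (((AnticyclotomicBigGaloisRep κ ρ𝒪).restrict (localMap K v)).toTopRep).ρ.invariants,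
          (C (p : 𝒪) : PowerSeries 𝒪) ^ m • w' = w)
    (hdivg : Function.Surjective fun x : BigRepModule 𝒪 p Ag ↦ (C (p : 𝒪) : PowerSeries 𝒪) • x)
    (hglobg : ∀ w ∈ (AnticyclotomicBigGaloisRep κ ρg).toTopRep.ρ.invariants,
      ∃ w' ∈ (AnticyclotomicBigGaloisRep κ ρg).toTopRep.ρ.invariants, (C (p : 𝒪) : PowerSeries 𝒪) ^ m • w' = w)
    (hlocg : ∀ v ∈ strictSet p 𝔮 S,
      ∀ w ∈ (((AnticyclotomicBigGaloisRep κ ρg).restrict (localMap K v)).toTopRep).ρ.invariants,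
        ∃ w' ∈ (((AnticyclotomicBigGaloisRep κ ρg).restrict (localMap K v)).toTopRep).ρ.invariants,
          (C (p : 𝒪) : PowerSeries 𝒪) ^ m • w' = w) :
    Nonempty ((XBig κ ρ𝒪 𝔮 S ⧸ (Ideal.span {(C (p : 𝒪) : PowerSeries 𝒪)}) ^ m •
        (⊤ : Submodule (PowerSeries 𝒪) (XBig κ ρ𝒪 𝔮 S))) ≃ₗ[PowerSeries 𝒪]
      (XBig κ ρg 𝔮 S ⧸ (Ideal.span {(C (p : 𝒪) : PowerSeries 𝒪)}) ^ m •
        (⊤ : Submodule (PowerSeries 𝒪) (XBig κ ρg 𝔮 S)))) := by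
  -- (b) on the big representations: `M_g[p^m] ≅ M_𝒪[p^m]`
  obtain ⟨θ⟩ := BigRep.nonempty_torsionRepIso_pow m κ.toContinuousMonoidHom ρg ρ𝒪 hb
  -- Lemma 2.1 on both sides, `selmerCongr` in between
  obtain ⟨e⟩ := nonempty_torsionBy_selmer_equiv_of_divisible (localMap K) (strictSet p 𝔮 S)
    (C (p : 𝒪) : PowerSeries 𝒪) m (AnticyclotomicBigGaloisRep κ ρ𝒪) (AnticyclotomicBigGaloisRep κ ρg)
    hdiv𝒪 hglob𝒪 hloc𝒪 hdivg hglobg hlocg θ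
  -- Pontryagin
  exact PontryaginCongruence.nonempty_quotIdealPow_equiv_of_torsionBy_equiv (C (p : 𝒪) : PowerSeries 𝒪) m e

/-! ### §2 The coefficient base change of the Selmer dual, from (SelBC) + (Frob) -/

variable {A : Type} [AddCommGroup A] [Module ℤ_[p] A] [TopologicalSpace A] [DiscreteTopology A]
  [TopologicalSpace (PowerSeries ℤ_[p])] [ContinuousSMul (PowerSeries ℤ_[p]) (BigRepModule ℤ_[p] p A)]

/-- **`X^Σ_𝔮(M_𝒪) ≃ₗ[𝒪⟦T⟧] 𝒪⟦T⟧ ⊗_Λ X^Σ_𝔮(M)` from (SelBC) + (Frob)**: Pontryagin duality of the Selmer-level base change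
(`CharacterModule.congr`) followed by `CoeffBaseChange.nonempty_characterModule_powerSeries_baseChange_equiv` (p498960).
CONDITIONAL on the two residual inputs. [cite: Skinner2016PacificMC, §2.6 (2-6-1) (the coefficient extension `T_f ⊗ 𝒪`)] -/
theorem nonempty_XBig_equiv_baseChange_of_selBC {ι : Type*} [Fintype ι] (κ : ZpExtension K p)
    (ρ : ContinuousRep (absoluteGaloisGroup K) ℤ_[p] A) (ρ𝒪 : ContinuousRep (absoluteGaloisGroup K) 𝒪 A𝒪)
    (𝔮 : HeightOneSpectrum (𝓞 K)) (S : Set (HeightOneSpectrum (𝓞 K)))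
    (hSelBC : Nonempty (selmerBig κ ρ𝒪 𝔮 S ≃ₗ[PowerSeries 𝒪]
      PowerSeries 𝒪 ⊗[IwasawaAlgebra p] selmerBig κ ρ 𝔮 S))
    (t₀ : 𝒪 →ₗ[ℤ_[p]] ℤ_[p]) (b b' : ι → 𝒪)
    (hfb : ∀ a : 𝒪, a = ∑ i, t₀ (a * b' i) • b i) (hfb' : ∀ a : 𝒪, a = ∑ i, t₀ (a * b i) • b' i) :
    Nonempty (XBig κ ρ𝒪 𝔮 S ≃ₗ[PowerSeries 𝒪] PowerSeries 𝒪 ⊗[IwasawaAlgebra p] XBig κ ρ 𝔮 S) := by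
  obtain ⟨e⟩ := hSelBC
  obtain ⟨f⟩ := CoeffBaseChange.nonempty_characterModule_powerSeries_baseChange_equiv (R := ℤ_[p]) (A := 𝒪)
    t₀ b b' hfb hfb' (selmerBig κ ρ 𝔮 S)
  exact ⟨(CharacterModule.congr e).trans f⟩

omit [TopologicalSpace 𝒪] [TopologicalSpace (PowerSeries 𝒪)] [TopologicalSpace (PowerSeries ℤ_[p])] in
/-- The ideal `(p)Λ = (C p)` extends to `(C p) ⊆ 𝒪⟦T⟧` along the structure map `Λ → 𝒪⟦T⟧` (Mathlib's
`PowerSeries.algebraPowerSeries`: `map (algebraMap ℤ_p 𝒪)`). [folklore] -/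
theorem map_span_C_natCast :
    (Ideal.span {(C (p : ℤ_[p]) : IwasawaAlgebra p)}).map (algebraMap (IwasawaAlgebra p) (PowerSeries 𝒪)) =
      Ideal.span {(C (p : 𝒪) : PowerSeries 𝒪)} := by
  rw [Ideal.map_span, Set.image_singleton, PowerSeries.algebraMap_apply'', map_C, map_natCast]

omit [TopologicalSpace 𝒪] [TopologicalSpace (PowerSeries 𝒪)] in
/-- Quotients modulo `J • ⊤` along a linear isomorphism. [folklore] -/
theorem nonempty_quotSMulTop_congr {R' : Type*} [CommRing R'] {M N : Type*} [AddCommGroup M] [Module R' M]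
    [AddCommGroup N] [Module R' N] (J : Ideal R') (f : M ≃ₗ[R'] N) :
    Nonempty ((M ⧸ J • (⊤ : Submodule R' M)) ≃ₗ[R'] (N ⧸ J • (⊤ : Submodule R' N))) :=
  ⟨Submodule.Quotient.equiv (J • ⊤) (J • ⊤) f
    (by rw [Submodule.map_smul'', Submodule.map_top, LinearEquiv.range])⟩

/-! ### §3 The binder `e m` of the consumer, assembled -/

/-- **THE MEMBER CONGRUENCE `e_m` ASSEMBLED** — VERBATIM the binder `e m` of
`P2.RoadFF.fittingCongruenceFrameTwoSlotAt_of_members_descent_le[_printed]` with `R' m := 𝒪⟦T⟧`, `Nm m := XBig κ ρ_g 𝔮 Σ`: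
from (F1) `X ≃ₗ[Λ] XBig κ ρ 𝔮 Σ` (abstract), (SelBC) + (Frob) (abstract, §2), and (b) + Lemma 2.1 (§1):
`((𝒪⟦T⟧ ⊗_Λ X) ⧸ ((C p)Λ·𝒪⟦T⟧)^m) ≃ₗ[𝒪⟦T⟧] (XBig κ ρ_g 𝔮 Σ ⧸ ((C p)Λ·𝒪⟦T⟧)^m)`. CONDITIONAL on every hypothesis;
nothing booked. [cite: Castella2018Erratum, (b), Lemma 2.1 and proof of Thm. 1.1 (p. 4)]
[cite: Skinner2016PacificMC, §2.6 (2-6-1) and §3.1 (b)] [cite: SkinnerUrban2014, Prop. 3.2.3] -/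
theorem nonempty_memberCongruence {ι : Type*} [Fintype ι] (κ : ZpExtension K p) (m : ℕ)
    {X : Type} [AddCommGroup X] [Module (IwasawaAlgebra p) X]
    (ρ : ContinuousRep (absoluteGaloisGroup K) ℤ_[p] A) (ρ𝒪 : ContinuousRep (absoluteGaloisGroup K) 𝒪 A𝒪)
    (ρg : ContinuousRep (absoluteGaloisGroup K) 𝒪 Ag)
    (𝔮 : HeightOneSpectrum (𝓞 K)) (S : Set (HeightOneSpectrum (𝓞 K)))
    (hF1 : Nonempty (X ≃ₗ[IwasawaAlgebra p] XBig κ ρ 𝔮 S))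
    (hSelBC : Nonempty (selmerBig κ ρ𝒪 𝔮 S ≃ₗ[PowerSeries 𝒪]
      PowerSeries 𝒪 ⊗[IwasawaAlgebra p] selmerBig κ ρ 𝔮 S))
    (t₀ : 𝒪 →ₗ[ℤ_[p]] ℤ_[p]) (b b' : ι → 𝒪)
    (hfb : ∀ a : 𝒪, a = ∑ i, t₀ (a * b' i) • b i) (hfb' : ∀ a : 𝒪, a = ∑ i, t₀ (a * b i) • b' i)
    (hb : ∃ e : Submodule.torsionBy 𝒪 Ag ((p : 𝒪) ^ m) ≃ₗ[𝒪] Submodule.torsionBy 𝒪 A𝒪 ((p : 𝒪) ^ m),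
      ∀ (g : absoluteGaloisGroup K) (a : Submodule.torsionBy 𝒪 Ag ((p : 𝒪) ^ m)),
        (e (TorsionControl.torsionRep ρg ((p : 𝒪) ^ m) g a) : A𝒪) = ρ𝒪 g (e a : A𝒪))
    (hdiv𝒪 : Function.Surjective fun x : BigRepModule 𝒪 p A𝒪 ↦ (C (p : 𝒪) : PowerSeries 𝒪) • x)
    (hglob𝒪 : ∀ w ∈ (AnticyclotomicBigGaloisRep κ ρ𝒪).toTopRep.ρ.invariants,
      ∃ w' ∈ (AnticyclotomicBigGaloisRep κ ρ𝒪).toTopRep.ρ.invariants, (C (p : 𝒪) : PowerSeries 𝒪) ^ m • w' = w)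
    (hloc𝒪 : ∀ v ∈ strictSet p 𝔮 S,
      ∀ w ∈ (((AnticyclotomicBigGaloisRep κ ρ𝒪).restrict (localMap K v)).toTopRep).ρ.invariants,
        ∃ w' ∈ (((AnticyclotomicBigGaloisRep κ ρ𝒪).restrict (localMap K v)).toTopRep).ρ.invariants,
          (C (p : 𝒪) : PowerSeries 𝒪) ^ m • w' = w)
    (hdivg : Function.Surjective fun x : BigRepModule 𝒪 p Ag ↦ (C (p : 𝒪) : PowerSeries 𝒪) • x)
    (hglobg : ∀ w ∈ (AnticyclotomicBigGaloisRep κ ρg).toTopRep.ρ.invariants,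
      ∃ w' ∈ (AnticyclotomicBigGaloisRep κ ρg).toTopRep.ρ.invariants, (C (p : 𝒪) : PowerSeries 𝒪) ^ m • w' = w)
    (hlocg : ∀ v ∈ strictSet p 𝔮 S,
      ∀ w ∈ (((AnticyclotomicBigGaloisRep κ ρg).restrict (localMap K v)).toTopRep).ρ.invariants,
        ∃ w' ∈ (((AnticyclotomicBigGaloisRep κ ρg).restrict (localMap K v)).toTopRep).ρ.invariants,
          (C (p : 𝒪) : PowerSeries 𝒪) ^ m • w' = w) :
    Nonempty ((((PowerSeries 𝒪) ⊗[IwasawaAlgebra p] X) ⧸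
        (((Ideal.span {(C (p : ℤ_[p]) : IwasawaAlgebra p)}).map
            (algebraMap (IwasawaAlgebra p) (PowerSeries 𝒪))) ^ m •
          (⊤ : Submodule (PowerSeries 𝒪) ((PowerSeries 𝒪) ⊗[IwasawaAlgebra p] X))))
        ≃ₗ[PowerSeries 𝒪]
      (XBig κ ρg 𝔮 S ⧸ (((Ideal.span {(C (p : ℤ_[p]) : IwasawaAlgebra p)}).map
            (algebraMap (IwasawaAlgebra p) (PowerSeries 𝒪))) ^ m •
          (⊤ : Submodule (PowerSeries 𝒪) (XBig κ ρg 𝔮 S))))) := by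
  rw [map_span_C_natCast]
  -- `𝒪⟦T⟧ ⊗ X ≃ 𝒪⟦T⟧ ⊗ XBig(M) ≃ XBig(M_𝒪)`
  obtain ⟨f1⟩ := hF1
  obtain ⟨f2⟩ := nonempty_XBig_equiv_baseChange_of_selBC κ ρ ρ𝒪 𝔮 S hSelBC t₀ b b' hfb hfb'
  have f : (PowerSeries 𝒪) ⊗[IwasawaAlgebra p] X ≃ₗ[PowerSeries 𝒪] XBig κ ρ𝒪 𝔮 S :=
    (f1.baseChange (IwasawaAlgebra p) (PowerSeries 𝒪) _ _).trans f2.symm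
  obtain ⟨g⟩ := nonempty_quotSMulTop_congr ((Ideal.span {(C (p : 𝒪) : PowerSeries 𝒪)}) ^ m) f
  obtain ⟨h⟩ := nonempty_quotPow_XBig_equiv_of_torsionCongruence κ m ρ𝒪 ρg 𝔮 S hb hdiv𝒪 hglob𝒪 hloc𝒪
    hdivg hglobg hlocg
  exact ⟨g.trans h⟩

end Summit.BirchSwinnertonDyer.Rank1Residual.X11b.RoadFFMember

end
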